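import Mathlib.LinearAlgebra.Matrix.Charpoly.Univ
import Mathlib.Topology.Algebra.MvPolynomial
import Literature.NumberTheory.Rogawski1990.Ch12Sec7CharacterInputs        -- ★ the socket's vocabulary: `cmDatum … .Local`, `IrrClass.smoothTrace`, `IsRegularElt`, `IsLocSmooth`, `unitModulusChar`, `Polynomial.discr`
import Literature.NumberTheory.Automorphic.LocalRingUnitModulusProduct      -- ★ `unitModulusChar_localRing_eq_prod` : `‖u‖ = Π_{w ∣ v} |u_w|_w`
import Literature.NumberTheory.Automorphic.LocalFieldHaarBalls              -- ★ `LocalFieldHaar.continuous_normAbs`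
import Literature.LinearAlgebra.Matrix.CharpolyDiscTwinBridge               -- ★ `discr_map_of_monic`, `isUnit_discr_iff_separable_of_monic`
import HarnessLib

/-!
# K2 · E3 ∕ U12-d — first rung of `sig_K2E3NormalizedCharBddNearSemisimple`: the weight `|D_G|^{1∕2} = √√‖u‖` is locally bounded at EVERY point,
# hence `|D_G|^{1∕2}·Θ_π` is locally bounded near every REGULAR point and the socket holds outright in rank `N ≤ 1`
# (Harish-Chandra 1999, Thm. 16.3 second clause — the part of it that needs no harmonic analysis)

HCML Track B «K2-LIT», cell `pub/hodgecm-mathlib`, crux H413 = `stmt-HodgeConjecture-24833` (`--supports … --as helper`), seat `hodgecm-mathlib-K2E3-p12` (g0).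
SOCKET (dealt BY NAME, SIGS-TABLE-K2E3 row #12, XL): `sig_K2E3NormalizedCharBddNearSemisimple` :123–141 of the tier-1 module
`Cruxes/H413/Lines/K2_E3_EllipticInputsSigs_U12Characters.lean` (sha16 996bf783bbcc5ded) — the LOCAL form at a semisimple point `s` of
★ `normalizedCharacter_locallyBounded` [HarishChandra1999 Thm. 16.3: «the function `|D_G|^{1∕2}·Θ_π` is locally bounded on `G`»], `G = U_N(H)(L⁺_v)`,
weight `√√‖u‖` for the unit `u` with `u·det(g)^{N−1} = disc(charpoly g)`.  THIS FILE does NOT pay the socket (its content at a SINGULAR semisimple `s` is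
Harish-Chandra's local character expansion, Thm. 16.2, plus the Lie-algebra bound Thm. 6.1 ∕ Cor. 6.2 — engines with no vocabulary in the tree yet); it lands
the part of the statement that is pure topology and is needed by every road:

* §1 `discr_charpoly_eq_eval_univ`, `continuous_discr_charpoly` — `x ↦ disc(charpoly x)` is the evaluation of the universal polynomial `disc(charpoly(X_ij))`
  (Mathlib `Matrix.charpoly.univ`, ★ `discr_map_of_monic`), hence continuous on `M_n(R)` for any topological commutative ring `R`;
  `isRegularElt_iff_isUnit_discr` — `g ∈ G′` iff `disc(charpoly g)` is a unit (★ `isUnit_discr_iff_separable_of_monic`).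
* §2 `coe_eq_discr_mul_det_inv_pow` — the socket's unit is PINNED: `u = disc(charpoly g)·det(g⁻¹)^{N−1}`; `exists_unit_rel_iff_isRegularElt` — such a `u`
  exists iff `g` is regular (so the socket's bound is vacuous exactly off `G′`, as the Literature docstring says); `unitModulusChar_eq_prod_normAbs` —
  `‖u‖ = Π_{w∣v} |(disc·det(g⁻¹)^{N−1})_w|_w` (★ `unitModulusChar_localRing_eq_prod`); `continuous_weightFun` — that closed form is CONTINUOUS on `G`
  (★ `continuous_normAbs`; `det(g⁻¹)` not `det(g)⁻¹`, so no division); `exists_nhds_weight_le` — **at every `s ∈ G` (regular or not) the weight `√√‖u‖`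
  is bounded on a neighbourhood of `s`.**
* §3 `exists_nhds_bound_of_norm_le` — if `Θ` itself is bounded near `s`, the socket's conclusion holds at `s`; `exists_nhds_bound_of_eventually_eq` — in
  particular if `Θ` is locally constant at `s`.
* §4 SOCKET-SHAPED COROLLARIES over the socket's own binders (statement text pasted from the socket; only the hypothesis on `s` differs):
  `normalizedCharBddNear_of_isRegularElt` — the conclusion of `sig_K2E3NormalizedCharBddNearSemisimple` at every REGULAR `s` (the socket's `hloc` makes `Θ`
  locally constant there); `normalizedCharBddNearSemisimple_of_le_one` — the socket's statement VERBATIM under the extra hypothesis `N ≤ 1` (every element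
  of `U_0`, `U_1` is regular: `charpoly` has degree `≤ 1`).
What remains for the socket (honest census, seat NOTES §Census): singular semisimple `s` in rank `N ≥ 2` = [HarishChandra1999, Thm. 16.2 + Thm. 6.1∕Cor. 6.2 +
§17 `|D_G(s·exp Y)| = |D_M(s·exp Y)|·|η_𝔪(Y)|`].  PROOF STRATEGY here: «universal discriminant polynomial + product formula for the module» (no case analysis
on `N`, no field-by-field computation — compare the `N = 3`∕`N = 2` closed forms ★ `F0P3cStCharTSDGField`∕`…DGFieldTwo`, which divide by `N(det)`).
HONEST LABEL: HC_CM is proved only modulo the 7 printed citations (2 remaining named inputs: hLiu418 = stmt-HodgeConjecture-24832, h413 =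
stmt-HodgeConjecture-24833) until rung 0 closes; this file is unconditional, proves no printed letter by itself, has no `sorry`, no axiom beyond the trio,
no `def`, no instance, no notation.

## References
* [HarishChandra1999] Harish-Chandra (notes by S. DeBacker, P. J. Sally, Jr.), *Admissible Invariant Distributions on Reductive p-adic Groups*, AMS ULS 16 (1999):
  Thm. 16.3 p. 77 (local boundedness of `|D_G|^{1∕2}Θ_π`), Thm. 16.2, Thm. 6.1 ∕ Cor. 6.2 p. 45, §17 (`D_G`), §21 p. 87.
* [Rogawski1990] J. D. Rogawski, *Automorphic Representations of Unitary Groups in Three Variables*, Ann. of Math. Stud. 123 (1990): §1.6 p. 5, §4.9 p. 54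
  (`D_G(γ) = |Π(1 − α(γ))|^{1∕2}`), §12.7 p. 193.
* [BasuPollackRoy2006] S. Basu, R. Pollack, M.-F. Roy, *Algorithms in Real Algebraic Geometry*, 2nd ed. (2006), Ch. 4 §4.1–§4.3 (discriminant of a monic
  polynomial as a polynomial in its coefficients; of `CharPol(M)` in the entries of `M`).
* [WeilBNT1967] A. Weil, *Basic Number Theory* (1967), Ch. I §2 (the module of a product of local fields).
-/

set_option autoImplicit false
set_option linter.dupNamespace false

noncomputable section

open NumberField IsDedekindDomain MeasureTheory Filter Topology Polynomial
open scoped Matrix MatrixGroups NNReal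
open Literature.NumberTheory.Rogawski1990 Literature.NumberTheory.Automorphic Literature.NumberTheory.Automorphic.UnitaryGroup
open Literature.NumberTheory.GaloisRepresentations Literature.NumberTheory.GaloisRepresentations.IsNonarchimedeanLocalField

namespace Summit.HodgeConjecture.HodgeConjecture.Cruxes.H413.K2E3NormalizedCharBddNearSemisimpleRegular

/-! ## §1 The discriminant of the characteristic polynomial: universal polynomial, continuity, regularity -/

section DiscrAlgebra

variable {R : Type*} [CommRing R] {n : Type*} [Fintype n] [DecidableEq n]

/-- `disc(charpoly x)` is the evaluation at the entries of `x` of the universal polynomial `disc(charpoly(X_ij)) ∈ R[X_ij]` (Mathlib `Matrix.charpoly.univ`,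
`univ_map_eval₂Hom`; the discriminant of a MONIC polynomial commutes with ring maps, ★ `discr_map_of_monic`).
[cite: BasuPollackRoy2006, Ch. 4 §4.3.1 pp. 119–127] -/
theorem discr_charpoly_eq_eval_univ (x : Matrix n n R) :
    x.charpoly.discr = MvPolynomial.eval (fun p : n × n => x p.1 p.2) (Matrix.charpoly.univ R n).discr := by
  have hmap : (Matrix.charpoly.univ R n).map (MvPolynomial.eval fun p : n × n => x p.1 p.2) = x.charpoly :=
    Matrix.charpoly.univ_map_eval₂Hom n (RingHom.id R) (fun p : n × n => x p.1 p.2)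
  rw [← Literature.LinearAlgebra.Matrix.discr_map_of_monic _ (Matrix.charpoly.univ_monic R n), hmap]

/-- `g ∈ GL_n(R)` is regular (★ `IsRegularElt`: separable characteristic polynomial) iff `disc(charpoly g)` is a unit of `R`
(★ `isUnit_discr_iff_separable_of_monic`; `charpoly` is monic). [cite: BasuPollackRoy2006, Ch. 4 §4.1 Prop. 4.3 pp. 101–105] -/
theorem isRegularElt_iff_isUnit_discr (g : GL n R) : IsRegularElt g ↔ IsUnit (g : Matrix n n R).charpoly.discr :=
  (Literature.LinearAlgebra.Matrix.isUnit_discr_iff_separable_of_monic (Matrix.charpoly_monic _)).symm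

end DiscrAlgebra

section DiscrTopology

variable {R : Type*} [CommRing R] [TopologicalSpace R] [IsTopologicalRing R] {n : Type*} [Fintype n] [DecidableEq n]

/-- **`x ↦ disc(charpoly x)` is continuous on `M_n(R)`** for every topological commutative ring `R` (a polynomial function of the entries,
`discr_charpoly_eq_eval_univ` + Mathlib `MvPolynomial.continuous_eval`). [cite: BasuPollackRoy2006, Ch. 4 §4.3.1 pp. 119–127] -/
theorem continuous_discr_charpoly : Continuous fun x : Matrix n n R => x.charpoly.discr := by
  have h : (fun x : Matrix n n R => x.charpoly.discr) =
      fun x : Matrix n n R => MvPolynomial.eval (fun p : n × n => x p.1 p.2) (Matrix.charpoly.univ R n).discr :=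
    funext fun x => discr_charpoly_eq_eval_univ x
  rw [h]
  exact (MvPolynomial.continuous_eval _).comp
    (continuous_pi fun p : n × n => (continuous_apply p.2).comp ((continuous_apply p.1).comp continuous_id))

end DiscrTopology

/-! ## §2 The weight `√√‖u‖` of the socket: pinned by `g`, continuous in `g`, locally bounded at every point of `G = U_N(H)(L⁺_v)` -/

section Weight

variable (L : Type) [Field L] [NumberField L] [IsCMField L] (N : ℕ) (H : Matrix (Fin N) (Fin N) L)
  (v : HeightOneSpectrum (𝓞 ↥(maximalRealSubfield L)))

/-- **The socket's unit is pinned by `g`:** if `u·det(g)^{N−1} = disc(charpoly g)` then `u = disc(charpoly g)·det(g⁻¹)^{N−1}` (`det(g)·det(g⁻¹) = 1`;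
no division in `R = Π_{w∣v} L_w`).  This is `u = ± D_G(g)` of [HarishChandra1999 §17] ∕ `D_G(γ)` of [Rogawski1990 §4.9 p. 54] in the socket's spelling.
[cite: HarishChandra1999, §17] [cite: Rogawski1990, §4.9 p. 54] -/
theorem coe_eq_discr_mul_det_inv_pow (g : (UnitaryGroup.cmDatum L N H).Local v) (u : (UnitaryGroup.LocalRing L v)ˣ)
    (hu : (u : UnitaryGroup.LocalRing L v) *
            (((g.val : GL (Fin N) (UnitaryGroup.LocalRing L v)) : Matrix (Fin N) (Fin N) (UnitaryGroup.LocalRing L v)).det) ^ (N - 1) =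
          (((g.val : GL (Fin N) (UnitaryGroup.LocalRing L v)) : Matrix (Fin N) (Fin N) (UnitaryGroup.LocalRing L v)).charpoly).discr) :
    (u : UnitaryGroup.LocalRing L v) =
      (((g.val : GL (Fin N) (UnitaryGroup.LocalRing L v)) : Matrix (Fin N) (Fin N) (UnitaryGroup.LocalRing L v)).charpoly).discr *
        (((g.val : GL (Fin N) (UnitaryGroup.LocalRing L v))⁻¹ : GL (Fin N) (UnitaryGroup.LocalRing L v)) : Matrix (Fin N) (Fin N) (UnitaryGroup.LocalRing L v)).det ^ (N - 1) := by
  set A : Matrix (Fin N) (Fin N) (UnitaryGroup.LocalRing L v) := ((g.val : GL (Fin N) (UnitaryGroup.LocalRing L v)).val : Matrix (Fin N) (Fin N) (UnitaryGroup.LocalRing L v)) with hA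
  set A' : Matrix (Fin N) (Fin N) (UnitaryGroup.LocalRing L v) := (((g.val : GL (Fin N) (UnitaryGroup.LocalRing L v))⁻¹ : GL (Fin N) (UnitaryGroup.LocalRing L v)).val : Matrix (Fin N) (Fin N) (UnitaryGroup.LocalRing L v)) with hA'
  have h1 : A.det * A'.det = 1 := by
    rw [hA, hA', ← Matrix.det_mul, Units.mul_inv, Matrix.det_one]
  calc (u : UnitaryGroup.LocalRing L v)
      = (u : UnitaryGroup.LocalRing L v) * (A.det * A'.det) ^ (N - 1) := by rw [h1, one_pow, mul_one]
    _ = (u : UnitaryGroup.LocalRing L v) * A.det ^ (N - 1) * A'.det ^ (N - 1) := by rw [mul_pow, mul_assoc]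
    _ = (A.charpoly).discr * A'.det ^ (N - 1) := by rw [hu]

/-- **A unit `u` with `u·det(g)^{N−1} = disc(charpoly g)` exists iff `g` is regular** (`disc` is then a unit, `isRegularElt_iff_isUnit_discr`; conversely take
`u := disc·det(g)^{−(N−1)}`).  So the socket's bound is an assertion on `G′` only, as print's «`|D_G|^{1∕2}Θ_π` locally bounded on `G`» read through
`Θ_π ∈ L¹_loc`. [cite: HarishChandra1999, Thm. 16.3, §17] -/
theorem exists_unit_rel_iff_isRegularElt (g : (UnitaryGroup.cmDatum L N H).Local v) :
    (∃ u : (UnitaryGroup.LocalRing L v)ˣ, (u : UnitaryGroup.LocalRing L v) *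
            (((g.val : GL (Fin N) (UnitaryGroup.LocalRing L v)) : Matrix (Fin N) (Fin N) (UnitaryGroup.LocalRing L v)).det) ^ (N - 1) =
          (((g.val : GL (Fin N) (UnitaryGroup.LocalRing L v)) : Matrix (Fin N) (Fin N) (UnitaryGroup.LocalRing L v)).charpoly).discr) ↔
    IsRegularElt (g.val : GL (Fin N) (UnitaryGroup.LocalRing L v)) := by
  rw [isRegularElt_iff_isUnit_discr]
  constructor
  · rintro ⟨u, hu⟩
    rw [← hu]
    exact u.isUnit.mul ((Matrix.isUnits_det_units _).pow _)
  · intro hd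
    obtain ⟨d, hd⟩ := hd
    refine ⟨d * ((Matrix.GeneralLinearGroup.det (g.val : GL (Fin N) (UnitaryGroup.LocalRing L v)))⁻¹) ^ (N - 1), ?_⟩
    have h1 : (((Matrix.GeneralLinearGroup.det (g.val : GL (Fin N) (UnitaryGroup.LocalRing L v)))⁻¹ : (UnitaryGroup.LocalRing L v)ˣ) : UnitaryGroup.LocalRing L v) *
        ((g.val : GL (Fin N) (UnitaryGroup.LocalRing L v)) : Matrix (Fin N) (Fin N) (UnitaryGroup.LocalRing L v)).det = 1 :=
      Units.inv_mul (Matrix.GeneralLinearGroup.det (g.val : GL (Fin N) (UnitaryGroup.LocalRing L v)))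
    rw [Units.val_mul, Units.val_pow_eq_pow_val, mul_assoc, ← mul_pow, h1, one_pow, mul_one, hd]

/-- **`‖u‖ = Π_{w ∣ v} |(disc(charpoly g)·det(g⁻¹)^{N−1})_w|_w`** for the socket's unit (★ `unitModulusChar_localRing_eq_prod`: the module of
`R = L ⊗_{L⁺} L⁺_v = Π_{w∣v} L_w` is the product of the normalised absolute values; `coe_eq_discr_mul_det_inv_pow`).
[cite: WeilBNT1967, Ch. I §2] [cite: Rogawski1990, §4.9 p. 54] -/
theorem unitModulusChar_eq_prod_normAbs (g : (UnitaryGroup.cmDatum L N H).Local v) (u : (UnitaryGroup.LocalRing L v)ˣ)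
    (hu : (u : UnitaryGroup.LocalRing L v) *
            (((g.val : GL (Fin N) (UnitaryGroup.LocalRing L v)) : Matrix (Fin N) (Fin N) (UnitaryGroup.LocalRing L v)).det) ^ (N - 1) =
          (((g.val : GL (Fin N) (UnitaryGroup.LocalRing L v)) : Matrix (Fin N) (Fin N) (UnitaryGroup.LocalRing L v)).charpoly).discr) :
    unitModulusChar (UnitaryGroup.LocalRing L v) u =
      ∏ w : PlacesOver L v, normAbs (w.1.adicCompletion L)
        (((((g.val : GL (Fin N) (UnitaryGroup.LocalRing L v)) : Matrix (Fin N) (Fin N) (UnitaryGroup.LocalRing L v)).charpoly).discr *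
          (((g.val : GL (Fin N) (UnitaryGroup.LocalRing L v))⁻¹ : GL (Fin N) (UnitaryGroup.LocalRing L v)) : Matrix (Fin N) (Fin N) (UnitaryGroup.LocalRing L v)).det ^ (N - 1)) w) := by
  rw [unitModulusChar_localRing_eq_prod L v u, coe_eq_discr_mul_det_inv_pow L N H v g u hu]

/-- **The closed form `g ↦ Π_{w∣v} |(disc(charpoly g)·det(g⁻¹)^{N−1})_w|_w` is continuous on `G = U_N(H)(L⁺_v)`** (`continuous_discr_charpoly`, Mathlib
`Continuous.matrix_det`, `Units.continuous_coe_inv`, ★ `LocalFieldHaar.continuous_normAbs`). [cite: HarishChandra1999, §17] [cite: Rogawski1990, §4.9 p. 54] -/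
theorem continuous_weightFun :
    Continuous fun g : (UnitaryGroup.cmDatum L N H).Local v =>
      ∏ w : PlacesOver L v, normAbs (w.1.adicCompletion L)
        (((((g.val : GL (Fin N) (UnitaryGroup.LocalRing L v)) : Matrix (Fin N) (Fin N) (UnitaryGroup.LocalRing L v)).charpoly).discr *
          (((g.val : GL (Fin N) (UnitaryGroup.LocalRing L v))⁻¹ : GL (Fin N) (UnitaryGroup.LocalRing L v)) : Matrix (Fin N) (Fin N) (UnitaryGroup.LocalRing L v)).det ^ (N - 1)) w) := by
  have hM : Continuous fun g : (UnitaryGroup.cmDatum L N H).Local v => ((g.val : GL (Fin N) (UnitaryGroup.LocalRing L v)).val : Matrix (Fin N) (Fin N) (UnitaryGroup.LocalRing L v)) :=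
    Units.continuous_val.comp continuous_subtype_val
  have hM' : Continuous fun g : (UnitaryGroup.cmDatum L N H).Local v => (((g.val : GL (Fin N) (UnitaryGroup.LocalRing L v))⁻¹ : GL (Fin N) (UnitaryGroup.LocalRing L v)).val : Matrix (Fin N) (Fin N) (UnitaryGroup.LocalRing L v)) :=
    Units.continuous_coe_inv.comp continuous_subtype_val
  have hdisc : Continuous fun g : (UnitaryGroup.cmDatum L N H).Local v => (((g.val : GL (Fin N) (UnitaryGroup.LocalRing L v)) : Matrix (Fin N) (Fin N) (UnitaryGroup.LocalRing L v)).charpoly).discr :=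
    continuous_discr_charpoly.comp hM
  have hdet : Continuous fun g : (UnitaryGroup.cmDatum L N H).Local v => (((g.val : GL (Fin N) (UnitaryGroup.LocalRing L v))⁻¹ : GL (Fin N) (UnitaryGroup.LocalRing L v)) : Matrix (Fin N) (Fin N) (UnitaryGroup.LocalRing L v)).det :=
    (continuous_id.matrix_det).comp hM'
  have hF : Continuous fun g : (UnitaryGroup.cmDatum L N H).Local v =>
      (((g.val : GL (Fin N) (UnitaryGroup.LocalRing L v)) : Matrix (Fin N) (Fin N) (UnitaryGroup.LocalRing L v)).charpoly).discr *
        (((g.val : GL (Fin N) (UnitaryGroup.LocalRing L v))⁻¹ : GL (Fin N) (UnitaryGroup.LocalRing L v)) : Matrix (Fin N) (Fin N) (UnitaryGroup.LocalRing L v)).det ^ (N - 1) :=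
    hdisc.mul (hdet.pow _)
  exact continuous_finsetProd _ fun w _ => LocalFieldHaar.continuous_normAbs.comp ((continuous_apply w).comp hF)

/-- **The weight `|D_G|^{1∕2} = √√‖u‖` is locally bounded at EVERY point of `G`** (regular or not): for each `s ∈ U_N(H)(L⁺_v)` there are an open `U ∋ s` and
`W` with `√√‖u‖ ≤ W` whenever `g ∈ U` and `u·det(g)^{N−1} = disc(charpoly g)` (the closed form is continuous at `s`, `continuous_weightFun`; the unit relation
reads it, `unitModulusChar_eq_prod_normAbs`).  The whole difficulty of [HarishChandra1999 Thm. 16.3] is therefore in `Θ_π` near the SINGULAR set, where this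
weight tends to `0`. [cite: HarishChandra1999, Thm. 16.3, §17] [cite: Rogawski1990, §4.9 p. 54; §12.7 p. 193] -/
theorem exists_nhds_weight_le (s : (UnitaryGroup.cmDatum L N H).Local v) :
    ∃ U : Set ((UnitaryGroup.cmDatum L N H).Local v), IsOpen U ∧ s ∈ U ∧
      ∃ W : ℝ, ∀ g ∈ U, ∀ u : (UnitaryGroup.LocalRing L v)ˣ,
        (u : UnitaryGroup.LocalRing L v) *
            (((g.val : GL (Fin N) (UnitaryGroup.LocalRing L v)) : Matrix (Fin N) (Fin N) (UnitaryGroup.LocalRing L v)).det) ^ (N - 1) =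
          (((g.val : GL (Fin N) (UnitaryGroup.LocalRing L v)) : Matrix (Fin N) (Fin N) (UnitaryGroup.LocalRing L v)).charpoly).discr →
        ((NNReal.sqrt (NNReal.sqrt (unitModulusChar (UnitaryGroup.LocalRing L v) u)) : ℝ≥0) : ℝ) ≤ W := by
  set F : (UnitaryGroup.cmDatum L N H).Local v → ℝ≥0 := fun g =>
      ∏ w : PlacesOver L v, normAbs (w.1.adicCompletion L)
        (((((g.val : GL (Fin N) (UnitaryGroup.LocalRing L v)) : Matrix (Fin N) (Fin N) (UnitaryGroup.LocalRing L v)).charpoly).discr *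
          (((g.val : GL (Fin N) (UnitaryGroup.LocalRing L v))⁻¹ : GL (Fin N) (UnitaryGroup.LocalRing L v)) : Matrix (Fin N) (Fin N) (UnitaryGroup.LocalRing L v)).det ^ (N - 1)) w) with hF
  have hFc : Continuous F := continuous_weightFun L N H v
  refine ⟨F ⁻¹' Set.Iio (F s + 1), hFc.isOpen_preimage _ isOpen_Iio, ?_, ((NNReal.sqrt (NNReal.sqrt (F s + 1)) : ℝ≥0) : ℝ), ?_⟩
  · exact Set.mem_preimage.2 (Set.mem_Iio.2 (lt_add_of_pos_right _ zero_lt_one))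
  · intro g hg u hu
    have hgF : F g < F s + 1 := Set.mem_Iio.1 (Set.mem_preimage.1 hg)
    have hmod : unitModulusChar (UnitaryGroup.LocalRing L v) u = F g := unitModulusChar_eq_prod_normAbs L N H v g u hu
    rw [hmod]
    exact NNReal.coe_le_coe.2 (NNReal.sqrt_le_sqrt.2 (NNReal.sqrt_le_sqrt.2 hgF.le))

end Weight

/-! ## §3 The socket's conclusion at a point where `Θ` is bounded ∕ locally constant -/

section LocallyBounded

variable (L : Type) [Field L] [NumberField L] [IsCMField L] (N : ℕ) (H : Matrix (Fin N) (Fin N) L)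
  (v : HeightOneSpectrum (𝓞 ↥(maximalRealSubfield L)))

/-- **If `Θ` is bounded on a neighbourhood of `s`, the normalised character `|D_G|^{1∕2}·Θ` is bounded on a neighbourhood of `s`** (the socket's conclusion at
`s`): intersect with the neighbourhood of `exists_nhds_weight_le` and multiply the two bounds. [cite: HarishChandra1999, Thm. 16.3] -/
theorem exists_nhds_bound_of_norm_le (Θ : (UnitaryGroup.cmDatum L N H).Local v → ℂ) (s : (UnitaryGroup.cmDatum L N H).Local v)
    (hΘ : ∃ V : Set ((UnitaryGroup.cmDatum L N H).Local v), IsOpen V ∧ s ∈ V ∧ ∃ M : ℝ, ∀ g ∈ V, ‖Θ g‖ ≤ M) :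
    ∃ U : Set ((UnitaryGroup.cmDatum L N H).Local v), IsOpen U ∧ s ∈ U ∧
      ∃ B : ℝ, ∀ g ∈ U, ∀ u : (UnitaryGroup.LocalRing L v)ˣ,
        (u : UnitaryGroup.LocalRing L v) *
            (((g.val : GL (Fin N) (UnitaryGroup.LocalRing L v)) : Matrix (Fin N) (Fin N) (UnitaryGroup.LocalRing L v)).det) ^ (N - 1) =
          (((g.val : GL (Fin N) (UnitaryGroup.LocalRing L v)) : Matrix (Fin N) (Fin N) (UnitaryGroup.LocalRing L v)).charpoly).discr →
        ((NNReal.sqrt (NNReal.sqrt (unitModulusChar (UnitaryGroup.LocalRing L v) u)) : ℝ≥0) : ℝ) * ‖Θ g‖ ≤ B := by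
  obtain ⟨V, hVo, hsV, M, hM⟩ := hΘ
  obtain ⟨U, hUo, hsU, W, hW⟩ := exists_nhds_weight_le L N H v s
  have hM0 : 0 ≤ M := (norm_nonneg (Θ s)).trans (hM s hsV)
  refine ⟨U ∩ V, hUo.inter hVo, ⟨hsU, hsV⟩, W * M, fun g hg u hu => ?_⟩
  exact mul_le_mul (hW g hg.1 u hu) (hM g hg.2) (norm_nonneg _) ((NNReal.coe_nonneg _).trans (hW g hg.1 u hu))

/-- **If `Θ` is locally constant at `s`** (`Θ = Θ(s)` eventually near `s` — the socket's hypothesis `hloc` at a REGULAR `s`), the socket's conclusion holds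
at `s` with the bound `W·|Θ(s)|`. [cite: HarishChandra1999, Thm. 16.3] -/
theorem exists_nhds_bound_of_eventually_eq (Θ : (UnitaryGroup.cmDatum L N H).Local v → ℂ) (s : (UnitaryGroup.cmDatum L N H).Local v)
    (hΘ : ∀ᶠ y in 𝓝 s, Θ y = Θ s) :
    ∃ U : Set ((UnitaryGroup.cmDatum L N H).Local v), IsOpen U ∧ s ∈ U ∧
      ∃ B : ℝ, ∀ g ∈ U, ∀ u : (UnitaryGroup.LocalRing L v)ˣ,
        (u : UnitaryGroup.LocalRing L v) *
            (((g.val : GL (Fin N) (UnitaryGroup.LocalRing L v)) : Matrix (Fin N) (Fin N) (UnitaryGroup.LocalRing L v)).det) ^ (N - 1) =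
          (((g.val : GL (Fin N) (UnitaryGroup.LocalRing L v)) : Matrix (Fin N) (Fin N) (UnitaryGroup.LocalRing L v)).charpoly).discr →
        ((NNReal.sqrt (NNReal.sqrt (unitModulusChar (UnitaryGroup.LocalRing L v) u)) : ℝ≥0) : ℝ) * ‖Θ g‖ ≤ B := by
  obtain ⟨V, hVsub, hVo, hsV⟩ := mem_nhds_iff.1 hΘ
  exact exists_nhds_bound_of_norm_le L N H v Θ s
    ⟨V, hVo, hsV, ‖Θ s‖, fun g hg => le_of_eq (congrArg (fun z : ℂ => ‖z‖) (hVsub hg))⟩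

end LocallyBounded

/-! ## §4 Socket-shaped corollaries: the conclusion of `sig_K2E3NormalizedCharBddNearSemisimple` at REGULAR points, and the socket itself in rank `N ≤ 1` -/

section Socket

/-- Every element of `GL_N(R)` is regular when `N ≤ 1` (`charpoly` is monic of degree `N ≤ 1`, and `1`, `X + c` are separable).
[cite: Rogawski1990, §3.1 p. 19] -/
theorem isRegularElt_of_le_one {R : Type*} [CommRing R] {N : ℕ} (hN : N ≤ 1) (g : GL (Fin N) R) : IsRegularElt g := by
  rw [isRegularElt_iff]
  rcases subsingleton_or_nontrivial R with hR | hR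
  · exact Polynomial.separable_of_subsingleton _
  have hmon : ((g : Matrix (Fin N) (Fin N) R).charpoly).Monic := Matrix.charpoly_monic _
  have hdeg : ((g : Matrix (Fin N) (Fin N) R).charpoly).natDegree = N := by
    rw [Matrix.charpoly_natDegree_eq_dim, Fintype.card_fin]
  rcases Nat.le_one_iff_eq_zero_or_eq_one.1 hN with h0 | h1
  · subst h0
    rw [hmon.natDegree_eq_zero.1 hdeg]
    exact separable_one
  · subst h1
    rw [hmon.eq_X_add_C hdeg]
    exact separable_X_add_C _

set_option maxHeartbeats 1600000 in
set_option synthInstance.maxHeartbeats 400000 in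
open scoped Classical in
/-- **`sig_K2E3NormalizedCharBddNearSemisimple` AT REGULAR POINTS.**  Binders and conclusion pasted from the socket (`Cruxes/H413/Lines/K2_E3_EllipticInputsSigs_U12Characters.lean`
:123–141); the hypothesis `IsSemisimple` on `s` is replaced by `IsRegularElt s` (regular elements ARE semisimple; this is the easy half of the case split every
proof of the socket makes).  Proof: the socket's `hloc` makes `Θ` locally constant at `s` (`exists_nhds_bound_of_eventually_eq`); the Haar measure, the class `π`,
`Θ ∈ L¹_loc` and the trace identity are not used on this branch. [cite: HarishChandra1999, Thm. 16.3 (first clause ⇒ second clause on `G′`)] [cite: Rogawski1990, §12.7 p. 192] -/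
theorem normalizedCharBddNear_of_isRegularElt :
  ∀ (L : Type) [Field L] [NumberField L] [IsCMField L] (N : ℕ) (H : Matrix (Fin N) (Fin N) L),
    (H.map (cmConjRingHom L))ᵀ = H → H.det ≠ 0 →
    ∀ (v : HeightOneSpectrum (𝓞 ↥(maximalRealSubfield L)))
      [MeasurableSpace ((UnitaryGroup.cmDatum L N H).Local v)] [BorelSpace ((UnitaryGroup.cmDatum L N H).Local v)]
      (μ : Measure ((UnitaryGroup.cmDatum L N H).Local v)) [μ.IsHaarMeasure]
      (c : IrrClass ((UnitaryGroup.cmDatum L N H).Local v)) (Θ : (UnitaryGroup.cmDatum L N H).Local v → ℂ),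
      LocallyIntegrable Θ μ →
      (∀ x : (UnitaryGroup.cmDatum L N H).Local v,
        IsRegularElt (x.val : GL (Fin N) (UnitaryGroup.LocalRing L v)) → ∀ᶠ y in 𝓝 x, Θ y = Θ x) →
      (∀ φ : (UnitaryGroup.cmDatum L N H).Local v → ℂ, IsLocSmooth φ → c.smoothTrace μ φ = ∫ x, φ x * Θ x ∂μ) →
    ∀ s : (UnitaryGroup.cmDatum L N H).Local v, IsRegularElt (s.val : GL (Fin N) (UnitaryGroup.LocalRing L v)) →
      ∃ U : Set ((UnitaryGroup.cmDatum L N H).Local v), IsOpen U ∧ s ∈ U ∧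
      ∃ B : ℝ, ∀ g ∈ U, ∀ u : (UnitaryGroup.LocalRing L v)ˣ,
        (u : UnitaryGroup.LocalRing L v) *
            (((g.val : GL (Fin N) (UnitaryGroup.LocalRing L v)) : Matrix (Fin N) (Fin N) (UnitaryGroup.LocalRing L v)).det) ^ (N - 1) =
          (((g.val : GL (Fin N) (UnitaryGroup.LocalRing L v)) : Matrix (Fin N) (Fin N) (UnitaryGroup.LocalRing L v)).charpoly).discr →
        ((NNReal.sqrt (NNReal.sqrt (unitModulusChar (UnitaryGroup.LocalRing L v) u)) : ℝ≥0) : ℝ) * ‖Θ g‖ ≤ B := by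
  intro L _ _ _ N H _ _ v _ _ μ _ c Θ _ hloc _ s hs
  exact exists_nhds_bound_of_eventually_eq L N H v Θ s (hloc s hs)

set_option maxHeartbeats 1600000 in
set_option synthInstance.maxHeartbeats 400000 in
open scoped Classical in
/-- **`sig_K2E3NormalizedCharBddNearSemisimple` IN RANK `N ≤ 1` — the socket's statement VERBATIM (pasted from `…Sigs_U12Characters.lean` :123–141) under the one
extra hypothesis `N ≤ 1`.**  `U_0` is trivial and `U_1(H)(L⁺_v)` is abelian with `charpoly g = X − g`: every element is regular (`isRegularElt_of_le_one`), so the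
regular branch `normalizedCharBddNear_of_isRegularElt` is the whole statement.  (For `N ≥ 2` the singular semisimple points carry Harish-Chandra's Thm. 16.2 +
Thm. 6.1 — not in this file.) [cite: HarishChandra1999, Thm. 16.3] [cite: Rogawski1990, §12.7 p. 192] -/
theorem normalizedCharBddNearSemisimple_of_le_one :
  ∀ (L : Type) [Field L] [NumberField L] [IsCMField L] (N : ℕ) (H : Matrix (Fin N) (Fin N) L), N ≤ 1 →
    (H.map (cmConjRingHom L))ᵀ = H → H.det ≠ 0 →
    ∀ (v : HeightOneSpectrum (𝓞 ↥(maximalRealSubfield L)))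
      [MeasurableSpace ((UnitaryGroup.cmDatum L N H).Local v)] [BorelSpace ((UnitaryGroup.cmDatum L N H).Local v)]
      (μ : Measure ((UnitaryGroup.cmDatum L N H).Local v)) [μ.IsHaarMeasure]
      (c : IrrClass ((UnitaryGroup.cmDatum L N H).Local v)) (Θ : (UnitaryGroup.cmDatum L N H).Local v → ℂ),
      LocallyIntegrable Θ μ →
      (∀ x : (UnitaryGroup.cmDatum L N H).Local v,
        IsRegularElt (x.val : GL (Fin N) (UnitaryGroup.LocalRing L v)) → ∀ᶠ y in 𝓝 x, Θ y = Θ x) →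
      (∀ φ : (UnitaryGroup.cmDatum L N H).Local v → ℂ, IsLocSmooth φ → c.smoothTrace μ φ = ∫ x, φ x * Θ x ∂μ) →
    ∀ s : (UnitaryGroup.cmDatum L N H).Local v, Module.End.IsSemisimple (Matrix.toLin' ((s.val : GL (Fin N) (UnitaryGroup.LocalRing L v)).val : Matrix (Fin N) (Fin N) (UnitaryGroup.LocalRing L v))) →
      ∃ U : Set ((UnitaryGroup.cmDatum L N H).Local v), IsOpen U ∧ s ∈ U ∧
      ∃ B : ℝ, ∀ g ∈ U, ∀ u : (UnitaryGroup.LocalRing L v)ˣ,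
        (u : UnitaryGroup.LocalRing L v) *
            (((g.val : GL (Fin N) (UnitaryGroup.LocalRing L v)) : Matrix (Fin N) (Fin N) (UnitaryGroup.LocalRing L v)).det) ^ (N - 1) =
          (((g.val : GL (Fin N) (UnitaryGroup.LocalRing L v)) : Matrix (Fin N) (Fin N) (UnitaryGroup.LocalRing L v)).charpoly).discr →
        ((NNReal.sqrt (NNReal.sqrt (unitModulusChar (UnitaryGroup.LocalRing L v) u)) : ℝ≥0) : ℝ) * ‖Θ g‖ ≤ B := by
  intro L _ _ _ N H hN hH hHd v _ _ μ _ c Θ hli hloc hrep s _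
  exact normalizedCharBddNear_of_isRegularElt L N H hH hHd v μ c Θ hli hloc hrep s (isRegularElt_of_le_one hN _)

end Socket

end Summit.HodgeConjecture.HodgeConjecture.Cruxes.H413.K2E3NormalizedCharBddNearSemisimpleRegular

end
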